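import Literature.IUT.HodgeArakelov.ModelReconstruction
import Literature.IUT.HodgeArakelov.MonoThetaCyclotomesBridge
import Literature.AnabelianGeometry.EtaleTheta.Discharge.Sec2LiftingProofs
import Literature.AnabelianGeometry.EtaleTheta.Discharge.Sec2Cor219iCoefficientAction

/-!
# Bridge B8, part 7: THE [IUTchII] Def. 1.1 (ii) rigidity isomorphism of `ModelReconstruction` is NATURAL
# under isomorphisms of mono-theta environments (proof-only companion of `ModelReconstruction`, p410630)

abc-iut cell, layer L6, seat abc-iut-L6-d6 (gen 3). Kernel REPAIR of finding **F-w5d145-1** on bridge B8 part 5b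
(abc-iut-w5-d145, `AUDIT-p410630.md`; witness `ModelReconstructionTwistWitness`, p414640/p415274): part 5b builds
the [IUTchII] Def. 1.1 output of a mono-theta environment `M` from an identification `e : Π_M ≃ Π^tp_Y[μ_N]` with
the [EtTh] model taken as a BARE topological-group isomorphism, and twisting `e` by `(a, y) ↦ (aⁿ, y)` changes the
rigidity isomorphism. Here we prove that along isomorphisms OF MONO-THETA ENVIRONMENTS the output is NATURAL —
which is what [IUTchII] Cor. 1.10 («arises from a functorial algorithm in the topological group `Π`», kurims
p. 47; sub-node C110-S10 of `plan/L6/SUBDAG-IUTchII-Cor-110.md`, level `N`) and Cor. 1.12 (ii) («the isomorphisms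
induced by the cyclotomic rigidity isomorphism of Corollary 1.10») consume. The [EtTh] ENGINE is abc-iut-w5-d145's
`RigidData.iso_inMu_thetaMod` / `iso_inMu_eq_coeffAut_of_cor219` (`Discharge/Sec2Cor219iCoefficientAction`,
p415693: by Cor. 2.19 (i) — `RigidData.Cor219_i_splittings`, FACT-LIST F-0626 — an automorphism of the model
mono-theta environment over `γ ∈ Aut(Π^tp_X)` acts on `μ_N` through `thetaMod ∘ γ`), imported, not restated.

* §1 (`ModelCyclotomes`, over L2's `RigidData`): the engine repackaged for the binders used on the L6 side
  (`iso_apply_inMu_thetaMod_of_cor219`), the FIBRE case (`iso_apply_inMu_of_over_id`: an automorphism over the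
  identity of `Π^tp_Y` fixes `μ_N` pointwise; cf. L2's `inMu_fixed_of_prop214_i` from Prop. 2.14 (i), F-0631),
  and the CONVERSE of the twist witness (`not_exists_iso_of_pow_ne` / `…'`): a topological automorphism over the
  identity acting on `μ_N` by `a ↦ aⁿ` with some `aⁿ ≠ a` underlies NO automorphism of the mono-theta environment.
* §2 (`ModelFrame`, part 5b's objects): replacing `e` by `e ≫ α` leaves `Π_μ(M)`, `(l·Δ_Θ)(M)`, `Π_X(M)` unchanged
  and twists `Π_M ↠ Π_Y(M)` by `γ`; the Def. 1.1 (ii) isomorphisms satisfy the NATURALITY SQUARE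
  `iso_{e ≫ α}[γ g] = iso_e[g]` in `Π_M` (`coe_cyclotomicRigidity_trans_mk`); in the fibre THE isomorphism is
  literally independent of the identification (`coe_cyclotomicRigidity_trans_eq_of_over_id`, from F-0626, and
  `…'` from F-0631 — the latter PROVED at the [EtTh] §1 model of origin by L2's `rigidData_prop214_i`); and the
  two-identification forms over [EtTh] isomorphisms `ε, ε' : M ⥲ M(η)` (`coe_cyclotomicRigidity_eq_of_iso_over_id`,
  `coe_cyclotomicRigidity_eq_of_iso_over`), via part 2's `etaleIsoSymm` / `etaleIsoTrans`.

HONEST FRAMING: proof-only (no definitions, no new named facts); [EtTh] inputs BY NAME as hypotheses; nothing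
disputed is asserted; no side is taken on [IUTchIII] Cor. 3.12; typed ≠ discharged. Sources: [IUTchII] §1 Def. 1.1
(ii), Cor. 1.10 [claim: Mochizuki2012, status: disputed] (IUTchII §1 Cor 1.10, kurims p.47);
[cite: MochizukiEtTh2009, Cor 2.19(i) p.64]; [cite: MochizukiEtTh2009, Cor 2.18(iv) p.61].
-/

noncomputable section

namespace Literature.IUT.HodgeArakelov

universe u

open Literature.AnabelianGeometry.EtaleTheta
open scoped Literature.AnabelianGeometry.EtaleTheta

namespace ModelCyclotomes

variable {N : ℕ+} {l : ℕ} (R : RigidData.{u} N l)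

/-! ## §1. Over L2's `RigidData`: the engine repackaged, the fibre case, the converse of the twist witness -/

/-- **[EtTh] Cor. 2.19 (i) ⇒ a mono-theta automorphism over `γ` acts on `μ_N` through `thetaMod ∘ γ`** — L2's
`RigidData.iso_inMu_thetaMod` (abc-iut-w5-d145, p415693) repackaged for `g : l·Δ_Θ`, a bi-continuous `γ` and the
named statement `Cor219_i_splittings` (F-0626): `α(ι(θ g)) = ι(θ(γ g))`. [cite: MochizukiEtTh2009, Cor 2.19(i) p.64] -/
theorem iso_apply_inMu_thetaMod_of_cor219 (h219 : R.Cor219_i_splittings) {η : R.PiYdd → R.mu}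
    (hη : η ∈ R.thetaCocycles) (α : (R.modelMono hη).Iso (R.modelMono hη)) (γ : R.PiX ≃ₜ* R.PiX)
    (hαγ : ∀ x : R.env, ((CycEnvelope.proj R.augY R.chi (α.e x) : R.PiY) : R.PiX) =
      γ ((CycEnvelope.proj R.augY R.chi x : R.PiY) : R.PiX))
    (g : R.lDeltaTheta) (hγg : γ g ∈ R.lDeltaTheta) :
    α.e (CycEnvelope.inMu R.augY R.chi (R.thetaMod g)) =
      CycEnvelope.inMu R.augY R.chi (R.thetaMod ⟨γ g, hγg⟩) := by
  have hgY : (g : R.PiX) ∈ R.PiYdd := (R.lDeltaTheta_le g.2).1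
  obtain ⟨_, h⟩ := RigidData.iso_inMu_thetaMod hη α.e γ.toMulEquiv hαγ (h219 η hη α).1 (h219 η hη α).2
    ⟨(g : R.PiX), hgY⟩ g.2
  exact h

/-- Under Cor. 2.19 (i), `γ(l·Δ_Θ) ⊆ Π^tp_Ÿ ∩ l·Δ_Θ` for any `γ ∈ Aut(Π^tp_X)` under a mono-theta automorphism
(no appeal to Cor. 2.18 (i)); from L2's `RigidData.iso_sAlg_eq`. [cite: MochizukiEtTh2009, Cor 2.19(i) p.64] -/
theorem apply_mem_lDeltaTheta_of_iso_over (h219 : R.Cor219_i_splittings) {η : R.PiYdd → R.mu}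
    (hη : η ∈ R.thetaCocycles) (α : (R.modelMono hη).Iso (R.modelMono hη)) (γ : R.PiX ≃ₜ* R.PiX)
    (hαγ : ∀ x : R.env, ((CycEnvelope.proj R.augY R.chi (α.e x) : R.PiY) : R.PiX) =
      γ ((CycEnvelope.proj R.augY R.chi x : R.PiY) : R.PiX))
    (g : R.PiX) (hg : g ∈ R.lDeltaTheta) : γ g ∈ R.PiYdd ∧ γ g ∈ R.lDeltaTheta := by
  obtain ⟨hY, hL, -⟩ := RigidData.iso_sAlg_eq α.e γ.toMulEquiv hαγ (h219 η hη α).1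
    ⟨g, (R.lDeltaTheta_le hg).1⟩ hg
  exact ⟨hY, hL⟩

/-- **Fibre case**: an automorphism of the model mono-theta environment `M(η)` over the IDENTITY of `Π^tp_Y`
fixes the cyclotome `μ_N` pointwise — from Cor. 2.19 (i) (F-0626; cf. L2's `inMu_fixed_of_prop214_i` for the
same conclusion from Prop. 2.14 (i), F-0631). [cite: MochizukiEtTh2009, Cor 2.18(iv) p.63] -/
theorem iso_apply_inMu_of_over_id (h219 : R.Cor219_i_splittings) {η : R.PiYdd → R.mu}
    (hη : η ∈ R.thetaCocycles) (α : (R.modelMono hη).Iso (R.modelMono hη))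
    (hα : ∀ x : R.env, CycEnvelope.proj R.augY R.chi (α.e x) = CycEnvelope.proj R.augY R.chi x) (a : R.mu) :
    α.e (CycEnvelope.inMu R.augY R.chi a) = CycEnvelope.inMu R.augY R.chi a := by
  obtain ⟨g, rfl⟩ := R.thetaMod_surjective a
  have hαγ : ∀ x : R.env, ((CycEnvelope.proj R.augY R.chi (α.e x) : R.PiY) : R.PiX) =
      (ContinuousMulEquiv.refl R.PiX) ((CycEnvelope.proj R.augY R.chi x : R.PiY) : R.PiX) := fun x => by
    rw [hα]; rfl
  exact iso_apply_inMu_thetaMod_of_cor219 R h219 hη α (ContinuousMulEquiv.refl R.PiX) hαγ g g.2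

/-- **Converse of the twist witness** (`ModelReconstructionTwistWitness`, p414640): a topological automorphism
`τ` of `Π^tp_Y[μ_N]` over the identity of `Π^tp_Y` acting on `μ_N` by `a ↦ aⁿ` with `aⁿ ≠ a` for some `a`
underlies NO automorphism of the mono-theta environment `M(η)` — given Cor. 2.19 (i) (F-0626).
[cite: MochizukiEtTh2009, Cor 2.18(iv) p.63] -/
theorem not_exists_iso_of_pow_ne (h219 : R.Cor219_i_splittings) {η : R.PiYdd → R.mu}
    (hη : η ∈ R.thetaCocycles) (τ : R.env ≃ₜ* R.env)
    (hτ : ∀ x : R.env, CycEnvelope.proj R.augY R.chi (τ x) = CycEnvelope.proj R.augY R.chi x) {n : ℕ}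
    (hτμ : ∀ a : R.mu, τ (CycEnvelope.inMu R.augY R.chi a) = CycEnvelope.inMu R.augY R.chi (a ^ n))
    {a : R.mu} (ha : a ^ n ≠ a) :
    ¬ ∃ α : (R.modelMono hη).Iso (R.modelMono hη), α.e = τ := by
  rintro ⟨α, rfl⟩
  exact ha (SemidirectProduct.inl_injective
    ((hτμ a).symm.trans (iso_apply_inMu_of_over_id R h219 hη α hτ a)))

/-- The same converse from Prop. 2.14 (i) (F-0631) instead of Cor. 2.19 (i), via L2's `inMu_fixed_of_prop214_i`.
[cite: MochizukiEtTh2009, Cor 2.18(iv) p.63] -/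
theorem not_exists_iso_of_pow_ne' (h214 : R.Prop214_i) {η : R.PiYdd → R.mu}
    (hη : η ∈ R.thetaCocycles) (τ : R.env ≃ₜ* R.env)
    (hτ : ∀ x : R.env, CycEnvelope.proj R.augY R.chi (τ x) = CycEnvelope.proj R.augY R.chi x) {n : ℕ}
    (hτμ : ∀ a : R.mu, τ (CycEnvelope.inMu R.augY R.chi a) = CycEnvelope.inMu R.augY R.chi (a ^ n))
    {a : R.mu} (ha : a ^ n ≠ a) :
    ¬ ∃ α : (R.modelMono hη).Iso (R.modelMono hη), α.e = τ := by
  rintro ⟨α, rfl⟩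
  exact ha (SemidirectProduct.inl_injective
    ((hτμ a).symm.trans (R.inMu_fixed_of_prop214_i h214 hη α hτ a)))

/-- `intModEquiv` on the class of `g ∈ l·Δ_Θ` in t1's carrier is `thetaMod g`.
[cite: MochizukiEtTh2009, Cor 2.19(i) p.64] -/
theorem intModEquiv_mk_symm_mk (g : R.lDeltaTheta) :
    intModEquiv R (((intCycEquiv R).symm (g : lDeltaQuot R) : (intCyc R).carrier) :
      ModPow (intCyc R).carrier (N : ℕ)) = R.thetaMod g := by
  unfold intModEquiv
  rw [MulEquiv.trans_apply, modPowCongr_mk, MulEquiv.apply_symm_apply, lDeltaModEquiv_mk_mk]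

end ModelCyclotomes

/-! ## §2. Naturality of the Def. 1.1 output of `ModelReconstruction` (bridge B8 part 5b) -/

namespace ModelFrame

open ModelCyclotomes MonoThetaBridge

variable {S : ThetaSetting.{u}} {l : ℕ} {R : RigidData.{u} S.N l} (F : ModelFrame S R)
  {M : MonoThetaEnv S} (e : M.Pi ≃ₜ* R.env)

/-- `Π_M ↠ Π_Y(M)` at the identification `e ≫ τ` is `Π_M ↠ Π_Y(M)` at `e` followed by `γ`, for any topological
automorphism `τ` of the model over `γ ∈ Aut(Π^tp_X)`. [claim: Mochizuki2012, status: disputed] (IUTchII §1 Def 1.1 (i), kurims p.21) -/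
theorem coe_projY_reconstruction_trans (τ : R.env ≃ₜ* R.env) (γ : R.PiX ≃ₜ* R.PiX)
    (hτγ : ∀ x : R.env, ((CycEnvelope.proj R.augY R.chi (τ x) : R.PiY) : R.PiX) =
      γ ((CycEnvelope.proj R.augY R.chi x : R.PiY) : R.PiX)) (m : M.Pi) :
    (((F.reconstruction (e.trans τ)).projY m : ↥R.PiY) : R.PiX) =
      γ (((F.reconstruction e).projY m : ↥R.PiY) : R.PiX) :=
  hτγ (e m)

/-- In the fibre (`τ` over the identity of `Π^tp_Y`) the quotient `Π_M ↠ Π_Y(M)` is unchanged.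
[claim: Mochizuki2012, status: disputed] (IUTchII §1 Def 1.1 (i), kurims p.21) -/
theorem projY_reconstruction_trans_of_over_id (τ : R.env ≃ₜ* R.env)
    (hτ : ∀ x : R.env, CycEnvelope.proj R.augY R.chi (τ x) = CycEnvelope.proj R.augY R.chi x) :
    (F.reconstruction (e.trans τ)).projY = (F.reconstruction e).projY :=
  MonoidHom.ext fun m => hτ (e m)

/-- **`Π_μ(M)` is unchanged** under `e ↦ e ≫ τ` for `τ` over any `γ ∈ Aut(Π^tp_X)`.
[claim: Mochizuki2012, status: disputed] (IUTchII §1 Def 1.1 (i), kurims p.21) -/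
theorem extCyc_reconstruction_trans (τ : R.env ≃ₜ* R.env) (γ : R.PiX ≃ₜ* R.PiX)
    (hτγ : ∀ x : R.env, ((CycEnvelope.proj R.augY R.chi (τ x) : R.PiY) : R.PiX) =
      γ ((CycEnvelope.proj R.augY R.chi x : R.PiY) : R.PiX)) :
    (F.reconstruction (e.trans τ)).extCyc = (F.reconstruction e).extCyc := by
  ext m
  rw [MonoidHom.mem_ker, MonoidHom.mem_ker, ← OneMemClass.coe_eq_one, ← OneMemClass.coe_eq_one,
    coe_projY_reconstruction_trans F e τ γ hτγ m, map_eq_one_iff γ γ.injective]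

/-- **`(l·Δ_Θ)(M)` is unchanged** under `e ↦ e ≫ τ` (it does not depend on `e` at all; likewise `Π_X(M)`, `G(M)`
and the interior action). [claim: Mochizuki2012, status: disputed] (IUTchII §1 Def 1.1 (i), kurims p.21) -/
theorem intCyc_reconstruction_trans (τ : R.env ≃ₜ* R.env) :
    (F.reconstruction (e.trans τ)).intCyc = (F.reconstruction e).intCyc := rfl

/-- **The identification `μ_N ≅ Π_μ(M)` is natural**: `extEquiv_{e ≫ α}(θ(γ g)) = extEquiv_e(θ(g))` in `Π_M` for
an automorphism `α` of the model mono-theta environment over `γ` (input BY NAME: `Cor219_i_splittings`, F-0626).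
[claim: Mochizuki2012, status: disputed] (IUTchII §1 Def 1.1 (i), kurims p.21) -/
theorem coe_extEquiv_trans_thetaMod (h219 : R.Cor219_i_splittings) {η : R.PiYdd → R.mu}
    (hη : η ∈ R.thetaCocycles) (α : (R.modelMono hη).Iso (R.modelMono hη)) (γ : R.PiX ≃ₜ* R.PiX)
    (hαγ : ∀ x : R.env, ((CycEnvelope.proj R.augY R.chi (α.e x) : R.PiY) : R.PiX) =
      γ ((CycEnvelope.proj R.augY R.chi x : R.PiY) : R.PiX))
    (g : R.lDeltaTheta) (hγg : γ g ∈ R.lDeltaTheta) :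
    (extEquiv (e.trans α.e) (R.thetaMod ⟨γ g, hγg⟩) : M.Pi) = (extEquiv e (R.thetaMod g) : M.Pi) := by
  rw [coe_extEquiv, coe_extEquiv, ← iso_apply_inMu_thetaMod_of_cor219 R h219 hη α γ hαγ g hγg]
  show e.symm (α.e.symm (α.e _)) = _
  rw [ContinuousMulEquiv.symm_apply_apply]

/-- In the fibre: `extEquiv_{e ≫ τ} = extEquiv_e` pointwise in `Π_M` for any topological automorphism `τ` of the
model fixing `μ_N` pointwise. [claim: Mochizuki2012, status: disputed] (IUTchII §1 Def 1.1 (i), kurims p.21) -/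
theorem coe_extEquiv_trans_eq_of_fix (τ : R.env ≃ₜ* R.env)
    (hfix : ∀ a : R.mu, τ (CycEnvelope.inMu R.augY R.chi a) = CycEnvelope.inMu R.augY R.chi a) (a : R.mu) :
    (extEquiv (e.trans τ) a : M.Pi) = (extEquiv e a : M.Pi) := by
  rw [coe_extEquiv, coe_extEquiv]
  conv_lhs => rw [← hfix]
  show e.symm (τ.symm (τ _)) = _
  rw [ContinuousMulEquiv.symm_apply_apply]

/-- The rigidity isomorphism of part 5b on elements of `Π_M`: `iso_e(c) = e⁻¹(ι(intModEquiv c))`.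
[claim: Mochizuki2012, status: disputed] (IUTchII §1 Def 1.1 (ii), kurims p.21) -/
theorem coe_cyclotomicRigidity_apply (c : ModPow (intCyc R).carrier (S.N : ℕ)) :
    ((F.cyclotomicRigidity e).iso c : M.Pi) = e.symm (CycEnvelope.inMu R.augY R.chi (intModEquiv R c)) := rfl

/-- **NATURALITY SQUARE ([IUTchII] Cor. 1.10 «functorial algorithm in `Π`», sub-node C110-S10 at level `N`).**
For an automorphism `α` of the model mono-theta environment over `γ ∈ Aut(Π^tp_X)` and `g ∈ l·Δ_Θ`:
`iso_{e ≫ α}[γ g] = iso_e[g]` in `Π_M` — transporting the mono-theta identification by `α` amounts to precomposing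
THE rigidity isomorphism with `γ`'s action on the interior cyclotome. Input BY NAME: [EtTh] Cor. 2.19 (i)
(`Cor219_i_splittings`, F-0626). [claim: Mochizuki2012, status: disputed] (IUTchII §1 Cor 1.10, kurims p.47) -/
theorem coe_cyclotomicRigidity_trans_mk (h219 : R.Cor219_i_splittings) {η : R.PiYdd → R.mu}
    (hη : η ∈ R.thetaCocycles) (α : (R.modelMono hη).Iso (R.modelMono hη)) (γ : R.PiX ≃ₜ* R.PiX)
    (hαγ : ∀ x : R.env, ((CycEnvelope.proj R.augY R.chi (α.e x) : R.PiY) : R.PiX) =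
      γ ((CycEnvelope.proj R.augY R.chi x : R.PiY) : R.PiX))
    (g : R.lDeltaTheta) (hγg : γ g ∈ R.lDeltaTheta) :
    ((F.cyclotomicRigidity (e.trans α.e)).iso
        (((intCycEquiv R).symm ((⟨γ g, hγg⟩ : R.lDeltaTheta) : lDeltaQuot R) : (intCyc R).carrier) :
          ModPow (intCyc R).carrier (S.N : ℕ)) : M.Pi) =
      ((F.cyclotomicRigidity e).iso
        (((intCycEquiv R).symm (g : lDeltaQuot R) : (intCyc R).carrier) :
          ModPow (intCyc R).carrier (S.N : ℕ)) : M.Pi) := by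
  rw [coe_cyclotomicRigidity_apply, coe_cyclotomicRigidity_apply, intModEquiv_mk_symm_mk,
    intModEquiv_mk_symm_mk, ← iso_apply_inMu_thetaMod_of_cor219 R h219 hη α γ hαγ g hγg]
  show e.symm (α.e.symm (α.e _)) = _
  rw [ContinuousMulEquiv.symm_apply_apply]

/-- **THE rigidity isomorphism is independent of the identification within the fibre**: for any topological
automorphism `τ` of the model fixing `μ_N` pointwise, `iso_{e ≫ τ} = iso_e` pointwise in `Π_M`.
[claim: Mochizuki2012, status: disputed] (IUTchII §1 Def 1.1 (ii), kurims p.21) -/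
theorem coe_cyclotomicRigidity_trans_eq_of_fix (τ : R.env ≃ₜ* R.env)
    (hfix : ∀ a : R.mu, τ (CycEnvelope.inMu R.augY R.chi a) = CycEnvelope.inMu R.augY R.chi a)
    (c : ModPow (intCyc R).carrier (S.N : ℕ)) :
    ((F.cyclotomicRigidity (e.trans τ)).iso c : M.Pi) = ((F.cyclotomicRigidity e).iso c : M.Pi) := by
  rw [coe_cyclotomicRigidity_apply, coe_cyclotomicRigidity_apply]
  conv_lhs => rw [← hfix]
  show e.symm (τ.symm (τ _)) = _
  rw [ContinuousMulEquiv.symm_apply_apply]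

/-- **Fibre independence from [EtTh] Cor. 2.19 (i)**: for an automorphism `α` of the model mono-theta environment
over the identity of `Π^tp_Y`, the Def. 1.1 (ii) isomorphisms at `e` and at `e ≫ α` coincide pointwise in `Π_M`
— contrast `ModelFrame.cyclotomicRigidity_not_determined` (p414640) for BARE topological identifications. Input BY
NAME: `Cor219_i_splittings` (F-0626). [claim: Mochizuki2012, status: disputed] (IUTchII §1 Def 1.1 (ii), kurims p.21) -/
theorem coe_cyclotomicRigidity_trans_eq_of_over_id (h219 : R.Cor219_i_splittings) {η : R.PiYdd → R.mu}
    (hη : η ∈ R.thetaCocycles) (α : (R.modelMono hη).Iso (R.modelMono hη))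
    (hα : ∀ x : R.env, CycEnvelope.proj R.augY R.chi (α.e x) = CycEnvelope.proj R.augY R.chi x)
    (c : ModPow (intCyc R).carrier (S.N : ℕ)) :
    ((F.cyclotomicRigidity (e.trans α.e)).iso c : M.Pi) = ((F.cyclotomicRigidity e).iso c : M.Pi) :=
  F.coe_cyclotomicRigidity_trans_eq_of_fix e α.e (iso_apply_inMu_of_over_id R h219 hη α hα) c

/-- **Fibre independence from [EtTh] Prop. 2.14 (i)** (via L2's `inMu_fixed_of_prop214_i`): the same conclusion
with input BY NAME `Prop214_i` (F-0631) — PROVED at the [EtTh] §1 model of origin by abc-iut-L2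
(`rigidData_prop214_i`, `Discharge/Sec2Prop214iiOfOrigin`), so there the statement holds modulo the origin
hypotheses only. [claim: Mochizuki2012, status: disputed] (IUTchII §1 Def 1.1 (ii), kurims p.21) -/
theorem coe_cyclotomicRigidity_trans_eq_of_over_id' (h214 : R.Prop214_i) {η : R.PiYdd → R.mu}
    (hη : η ∈ R.thetaCocycles) (α : (R.modelMono hη).Iso (R.modelMono hη))
    (hα : ∀ x : R.env, CycEnvelope.proj R.augY R.chi (α.e x) = CycEnvelope.proj R.augY R.chi x)
    (c : ModPow (intCyc R).carrier (S.N : ℕ)) :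
    ((F.cyclotomicRigidity (e.trans α.e)).iso c : M.Pi) = ((F.cyclotomicRigidity e).iso c : M.Pi) :=
  F.coe_cyclotomicRigidity_trans_eq_of_fix e α.e (R.inMu_fixed_of_prop214_i h214 hη α hα) c

/-- **Naturality for EVERY automorphism of the model mono-theta environment** (the automorphism `γ` of `Π^tp_X` is
supplied by L2's `exists_gamma_of_cor218` from [EtTh] Cor. 2.18 (i), (iii) BY NAME — F-0620, F-0623, F-0622): for
every `α` there is `γ ∈ Aut(Π^tp_X)` preserving `l·Δ_Θ`, with `α` over `γ` and `iso_{e ≫ α}[γ g] = iso_e[g]` for all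
`g ∈ l·Δ_Θ`. [claim: Mochizuki2012, status: disputed] (IUTchII §1 Cor 1.10, kurims p.47) -/
theorem exists_over_coe_cyclotomicRigidity_trans_mk (h218i : R.Cor218_i) (h218q : R.Cor218_iii_quotient)
    (h218P : R.Cor218_iii_PiX) (h219 : R.Cor219_i_splittings) {η : R.PiYdd → R.mu}
    (hη : η ∈ R.thetaCocycles) (α : (R.modelMono hη).Iso (R.modelMono hη)) :
    ∃ (γ : R.PiX ≃ₜ* R.PiX) (hL : ∀ g : R.lDeltaTheta, γ g ∈ R.lDeltaTheta),
      (∀ x : R.env, ((CycEnvelope.proj R.augY R.chi (α.e x) : R.PiY) : R.PiX) =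
        γ ((CycEnvelope.proj R.augY R.chi x : R.PiY) : R.PiX)) ∧
      ∀ g : R.lDeltaTheta,
        ((F.cyclotomicRigidity (e.trans α.e)).iso
            (((intCycEquiv R).symm ((⟨γ g, hL g⟩ : R.lDeltaTheta) : lDeltaQuot R) : (intCyc R).carrier) :
              ModPow (intCyc R).carrier (S.N : ℕ)) : M.Pi) =
          ((F.cyclotomicRigidity e).iso
            (((intCycEquiv R).symm (g : lDeltaQuot R) : (intCyc R).carrier) :
              ModPow (intCyc R).carrier (S.N : ℕ)) : M.Pi) := by
  obtain ⟨γ, hγ, -, -, hL⟩ := R.exists_gamma_of_cor218 h218i h218q h218P α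
  have hL' : ∀ g : R.lDeltaTheta, γ g ∈ R.lDeltaTheta := fun g =>
    hL.le (Subgroup.mem_map_of_mem _ g.2)
  exact ⟨γ, hL', hγ, fun g => F.coe_cyclotomicRigidity_trans_mk e h219 hη α γ hγ g (hL' g)⟩

/-! ### Two mono-theta identifications `ε, ε' : M ⥲ M(η)` (part 2's `toEtale`, `etaleIsoSymm`, `etaleIsoTrans`) -/

/-- Two [EtTh] isomorphisms `ε, ε'` from `M` to the model differ by the automorphism `ε⁻¹ ≫ ε'` of the model
mono-theta environment: `ε' = ε ≫ (ε⁻¹ ≫ ε')` on underlying topological groups.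
[cite: MochizukiEtTh2009, Def 2.13(ii) p.48] -/
theorem iso_e_eq_trans {η : R.PiYdd → R.mu} {hη : η ∈ R.thetaCocycles}
    (ε ε' : M.toEtale.Iso (R.modelMono hη)) :
    ε'.e = ε.e.trans (etaleIsoTrans (etaleIsoSymm ε) ε').e :=
  ContinuousMulEquiv.ext fun m => by
    show ε'.e m = ε'.e (ε.e.symm (ε.e m))
    rw [ContinuousMulEquiv.symm_apply_apply]

/-- **THE Def. 1.1 (ii) isomorphism does not depend on the mono-theta identification within the Cor. 2.18 (iv)
fibre**: if two [EtTh] isomorphisms `ε, ε' : M ⥲ M(η)` of mono-theta environments induce the SAME quotient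
`Π_M ↠ Π^tp_Y`, then the rigidity isomorphisms of part 5b at `ε` and at `ε'` coincide pointwise in `Π_M`
(and `Π_μ(M)`, `(l·Δ_Θ)(M)`, `Π_M ↠ Π_Y(M)` coincide). Input BY NAME: `Cor219_i_splittings` (F-0626).
[claim: Mochizuki2012, status: disputed] (IUTchII §1 Def 1.1 (ii), kurims p.21) -/
theorem coe_cyclotomicRigidity_eq_of_iso_over_id (h219 : R.Cor219_i_splittings) {η : R.PiYdd → R.mu}
    {hη : η ∈ R.thetaCocycles} (ε ε' : M.toEtale.Iso (R.modelMono hη))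
    (hproj : ∀ m : M.Pi, CycEnvelope.proj R.augY R.chi (ε'.e m) = CycEnvelope.proj R.augY R.chi (ε.e m))
    (c : ModPow (intCyc R).carrier (S.N : ℕ)) :
    ((F.cyclotomicRigidity ε'.e).iso c : M.Pi) = ((F.cyclotomicRigidity ε.e).iso c : M.Pi) := by
  have hover : ∀ x : R.env, CycEnvelope.proj R.augY R.chi ((etaleIsoTrans (etaleIsoSymm ε) ε').e x) =
      CycEnvelope.proj R.augY R.chi x := fun x => by
    show CycEnvelope.proj R.augY R.chi (ε'.e (ε.e.symm x)) = _
    rw [hproj, ContinuousMulEquiv.apply_symm_apply]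
  rw [iso_e_eq_trans ε ε']
  exact F.coe_cyclotomicRigidity_trans_eq_of_over_id ε.e h219 hη _ hover c

/-- **Naturality for two mono-theta identifications over `γ`**: if `ε' ≡ γ ∘ ε` on the quotient `Π^tp_Y`
(`γ ∈ Aut(Π^tp_X)` with `γ(l·Δ_Θ) ⊆ l·Δ_Θ`), then `iso_{ε'}[γ g] = iso_ε[g]` in `Π_M` for all `g ∈ l·Δ_Θ`. Input
BY NAME: `Cor219_i_splittings` (F-0626). [claim: Mochizuki2012, status: disputed] (IUTchII §1 Cor 1.10, kurims p.47) -/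
theorem coe_cyclotomicRigidity_eq_of_iso_over (h219 : R.Cor219_i_splittings) {η : R.PiYdd → R.mu}
    {hη : η ∈ R.thetaCocycles} (ε ε' : M.toEtale.Iso (R.modelMono hη)) (γ : R.PiX ≃ₜ* R.PiX)
    (hproj : ∀ m : M.Pi, ((CycEnvelope.proj R.augY R.chi (ε'.e m) : R.PiY) : R.PiX) =
      γ ((CycEnvelope.proj R.augY R.chi (ε.e m) : R.PiY) : R.PiX))
    (g : R.lDeltaTheta) (hγg : γ g ∈ R.lDeltaTheta) :
    ((F.cyclotomicRigidity ε'.e).iso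
        (((intCycEquiv R).symm ((⟨γ g, hγg⟩ : R.lDeltaTheta) : lDeltaQuot R) : (intCyc R).carrier) :
          ModPow (intCyc R).carrier (S.N : ℕ)) : M.Pi) =
      ((F.cyclotomicRigidity ε.e).iso
        (((intCycEquiv R).symm (g : lDeltaQuot R) : (intCyc R).carrier) :
          ModPow (intCyc R).carrier (S.N : ℕ)) : M.Pi) := by
  have hover : ∀ x : R.env,
      ((CycEnvelope.proj R.augY R.chi ((etaleIsoTrans (etaleIsoSymm ε) ε').e x) : R.PiY) : R.PiX) =
        γ ((CycEnvelope.proj R.augY R.chi x : R.PiY) : R.PiX) := fun x => by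
    show ((CycEnvelope.proj R.augY R.chi (ε'.e (ε.e.symm x)) : R.PiY) : R.PiX) = _
    rw [hproj, ContinuousMulEquiv.apply_symm_apply]
  rw [iso_e_eq_trans ε ε']
  exact F.coe_cyclotomicRigidity_trans_mk ε.e h219 hη _ γ hover g hγg

end ModelFrame

end Literature.IUT.HodgeArakelov

end
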